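import Literature.NumberTheory.EllipticCurves.Fisher2012.WeierstrassCollinearAdd
import Literature.NumberTheory.EllipticCurves.GaloisActionProofs
import Literature.NumberTheory.GaloisRepresentations.AbsGaloisGroup
import HarnessLib

/-!
# A fractional-linear `3`-torsion transfer datum gives a `Γ_K`-equivariant `E[3] ≃ E'[3]`
# (file F3 of the cell `b2b-bsdres` discharge of Fisher 2012 Thm. 13.2, `n = 3`; seat n1011-p02
# gen 7, 'T-F132-3')

HONEST FRAMING (cell `b2b-bsdres`, run/shared/lean/b2b/bsd-rank1-residual/, verbatim in every
file): the goal of the cell is to DELETE the COMBINATION-SHAPED residual classes of the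
Birch–Swinnerton-Dyer formula for ALL analytic-rank `≤ 1` elliptic curves over `ℚ` — "full BSD
formula for every rank `≤ 1` curve in class `C`" assembled STRICTLY from published theorems — so
that the rank-`≤ 1` remainder becomes exactly the CONSTRUCTION-SHAPED classes, which are TYPED
(missing-input `Prop`s), NOT attempted. This is not "finishing BSD". This file: a TOOL theorem of
our formalisation of a published proof; no definition, no named fact.

## What this file proves

`threeCongruent_of_fracLinearDatum`: let `W, W'` be elliptic curves over a field `K` of
characteristic `0` with `a₁ = a₃ = 0`, and `a b c d e ∈ K` with `ae ≠ bd`, `c ≠ 0` such that, over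
`K̄`, for every root `x` of `Ψ₃^{W}` the denominator `dx + e ≠ 0`, `x' := (ax + b)/(dx + e)` is a
root of `Ψ₃^{W'}`, and for every point `(x, y)` of `W` with `Ψ₃^{W}(x) = 0` the point
`(x', cy/(dx + e))` lies on `W'`.  Then there is an additive isomorphism `E[3] ≃ E'[3]` of the
geometric `3`-torsion commuting with `Γ_K`.

Proof: the map `f : O ↦ O, (x, y) ↦ ((ax+b)/(dx+e), cy/(dx+e))` is defined on `E[3]` (a point of
order `3` is not of order `2`, so `Ψ₃^{W}(x) = 0` by the tree's `three_smul_some_eq_zero_iff`), lands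
in `E'[3]` (same lemma backwards), commutes with `−` (`a₁ = a₃ = 0` on both sides) and with `Γ_K`
(coefficients in `K`), and is ADDITIVE: for `P ≠ ±Q` the point `R = −(P + Q)` is the third collinear
point (`WeierstrassCurve.Affine.collinear_negAdd`), a fractional-linear map of this shape preserves
collinearity (`collinear_fracLinear`), and on `W'` a collinear on-curve point off `{f P, f Q}` is
`−(f P + f Q)` (`add_eq_neg_of_collinear`) — Silverman *AEC* III.2.3.  It is injective (`ae ≠ bd`,
`c ≠ 0`), hence bijective as `#E[3] = #E'[3] = 9` (tree `card_torsionPoints_eq_sq_holds`).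

Used by `HesseFamilyThreeCongruenceProofs` with the datum of `HessePencilThreeIdentities` (Fisher's
Hesse pencil, `n = 3`).

References: [Fisher2012Hessian] Thm. 13.2; [SilvermanAEC2009] III.2.3, Cor. III.6.4, Ex. 3.7.
-/

noncomputable section

open scoped Classical

open WeierstrassCurve Literature.NumberTheory.EllipticCurves

namespace Literature.NumberTheory.EllipticCurves.Fisher2012

universe u

variable {K : Type u} [Field K]

section FracLinear

variable {F : Type*} [Field F]

/-! ### Fractional-linear maps `(x, y) ↦ ((a x + b)/(d x + e), c y/(d x + e))` preserve collinearity -/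

/-- Difference of abscissae under `x ↦ (a x + b)/(d x + e)`:
`x₂' − x₁' = (ae − bd)(x₂ − x₁)/((dx₁ + e)(dx₂ + e))`. [folklore] -/
private theorem fracLinear_X_sub_X {a b d e x₁ x₂ : F} (hD₁ : d * x₁ + e ≠ 0) (hD₂ : d * x₂ + e ≠ 0) :
    (a * x₂ + b) / (d * x₂ + e) - (a * x₁ + b) / (d * x₁ + e) =
      (a * e - b * d) * (x₂ - x₁) / ((d * x₁ + e) * (d * x₂ + e)) := by
  rw [div_sub_div _ _ hD₂ hD₁, div_eq_div_iff (mul_ne_zero hD₂ hD₁) (mul_ne_zero hD₁ hD₂)]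
  ring

/-- `x ↦ (a x + b)/(d x + e)` is injective where defined, provided `ae ≠ bd`. [folklore] -/
private theorem fracLinear_X_injective {a b d e x₁ x₂ : F} (hdet : a * e - b * d ≠ 0) (hD₁ : d * x₁ + e ≠ 0)
    (hD₂ : d * x₂ + e ≠ 0) (h : (a * x₁ + b) / (d * x₁ + e) = (a * x₂ + b) / (d * x₂ + e)) :
    x₁ = x₂ := by
  have h0 : (a * x₂ + b) / (d * x₂ + e) - (a * x₁ + b) / (d * x₁ + e) = 0 := by rw [h, sub_self]
  rw [fracLinear_X_sub_X hD₁ hD₂, div_eq_zero_iff] at h0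
  rcases h0 with h0 | h0
  · rcases mul_eq_zero.mp h0 with h0 | h0
    · exact absurd h0 hdet
    · exact (sub_eq_zero.mp h0).symm
  · exact absurd h0 (mul_ne_zero hD₁ hD₂)

/-- **Fractional-linear maps of the shape `(x, y) ↦ ((a x + b)/(d x + e), c y/(d x + e))` preserve
collinear triples** (they are restrictions of projective-linear maps of `ℙ²`): if
`(x₂ − x₁)(y₃ − y₁) = (x₃ − x₁)(y₂ − y₁)` and the three denominators are non-zero, the same
relation holds for the images. [folklore] -/
private theorem collinear_fracLinear {a b c d e x₁ x₂ x₃ y₁ y₂ y₃ : F} (hD₁ : d * x₁ + e ≠ 0)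
    (hD₂ : d * x₂ + e ≠ 0) (hD₃ : d * x₃ + e ≠ 0)
    (hcol : (x₂ - x₁) * (y₃ - y₁) = (x₃ - x₁) * (y₂ - y₁)) :
    ((a * x₂ + b) / (d * x₂ + e) - (a * x₁ + b) / (d * x₁ + e)) *
        (c * y₃ / (d * x₃ + e) - c * y₁ / (d * x₁ + e)) =
      ((a * x₃ + b) / (d * x₃ + e) - (a * x₁ + b) / (d * x₁ + e)) *
        (c * y₂ / (d * x₂ + e) - c * y₁ / (d * x₁ + e)) := by
  rw [fracLinear_X_sub_X hD₁ hD₂, fracLinear_X_sub_X hD₁ hD₃]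
  have e2 : c * y₃ / (d * x₃ + e) - c * y₁ / (d * x₁ + e) =
      c * ((d * x₁ + e) * (y₃ - y₁) - d * y₁ * (x₃ - x₁)) / ((d * x₁ + e) * (d * x₃ + e)) := by
    rw [div_sub_div _ _ hD₃ hD₁, div_eq_div_iff (mul_ne_zero hD₃ hD₁) (mul_ne_zero hD₁ hD₃)]
    ring
  have e4 : c * y₂ / (d * x₂ + e) - c * y₁ / (d * x₁ + e) =
      c * ((d * x₁ + e) * (y₂ - y₁) - d * y₁ * (x₂ - x₁)) / ((d * x₁ + e) * (d * x₂ + e)) := by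
    rw [div_sub_div _ _ hD₂ hD₁, div_eq_div_iff (mul_ne_zero hD₂ hD₁) (mul_ne_zero hD₁ hD₂)]
    ring
  rw [e2, e4, div_mul_div_comm, div_mul_div_comm,
    div_eq_div_iff (mul_ne_zero (mul_ne_zero hD₁ hD₂) (mul_ne_zero hD₁ hD₃))
      (mul_ne_zero (mul_ne_zero hD₁ hD₃) (mul_ne_zero hD₁ hD₂))]
  linear_combination (a * e - b * d) * c * (d * x₁ + e) *
    ((d * x₁ + e) * (d * x₃ + e) * ((d * x₁ + e) * (d * x₂ + e))) * hcol


end FracLinear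

section Lemmas

variable (W : WeierstrassCurve K)

/-- On a model with `a₁ = a₃ = 0`, `negY x y = −y` over `K̄`. [folklore] -/
private theorem negY_baseChange_of_a₁_a₃ (h1 : W.a₁ = 0) (h3 : W.a₃ = 0) (x y : (AlgebraicClosure K)) :
    (W.baseChange (AlgebraicClosure K)).toAffine.negY x y = -y := by
  simp [Affine.negY, WeierstrassCurve.baseChange, h1, h3]

/-- `τ ((ax + b)/(dx + e)) = (a(τx) + b)/(d(τx) + e)` for `a b d e ∈ K`, `τ ∈ Aut(K̄/K)`. [folklore] -/
private theorem algEquiv_fracLinear (τ : (AlgebraicClosure K) ≃ₐ[K] (AlgebraicClosure K)) (a b d e : K) (x : (AlgebraicClosure K)) :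
    τ (((algebraMap K (AlgebraicClosure K)) a * x + (algebraMap K (AlgebraicClosure K)) b) / ((algebraMap K (AlgebraicClosure K)) d * x + (algebraMap K (AlgebraicClosure K)) e)) = ((algebraMap K (AlgebraicClosure K)) a * τ x + (algebraMap K (AlgebraicClosure K)) b) / ((algebraMap K (AlgebraicClosure K)) d * τ x + (algebraMap K (AlgebraicClosure K)) e) := by
  simp only [map_div₀, map_add, map_mul, AlgEquiv.commutes]

/-- `τ (c y/(dx + e)) = c(τy)/(d(τx) + e)` for `c d e ∈ K`, `τ ∈ Aut(K̄/K)`. [folklore] -/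
private theorem algEquiv_fracLinear' (τ : (AlgebraicClosure K) ≃ₐ[K] (AlgebraicClosure K)) (c d e : K) (x y : (AlgebraicClosure K)) :
    τ ((algebraMap K (AlgebraicClosure K)) c * y / ((algebraMap K (AlgebraicClosure K)) d * x + (algebraMap K (AlgebraicClosure K)) e)) = (algebraMap K (AlgebraicClosure K)) c * τ y / ((algebraMap K (AlgebraicClosure K)) d * τ x + (algebraMap K (AlgebraicClosure K)) e) := by
  simp only [map_div₀, map_add, map_mul, AlgEquiv.commutes]

/-- `Ψ₃` of `W/K̄` has coefficients in `K`: `Ψ₃^{W_{K̄}}(τ x) = τ (Ψ₃^{W_{K̄}}(x))`, so its root set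
is `Aut(K̄/K)`-stable. [folklore] -/
private theorem eval_Ψ₃_baseChange_algEquiv (τ : (AlgebraicClosure K) ≃ₐ[K] (AlgebraicClosure K)) (x : (AlgebraicClosure K)) :
    (W.baseChange (AlgebraicClosure K)).Ψ₃.eval (τ x) = τ ((W.baseChange (AlgebraicClosure K)).Ψ₃.eval x) := by
  have hΨK : ∀ z : (AlgebraicClosure K), (W.baseChange (AlgebraicClosure K)).Ψ₃.eval z = Polynomial.aeval z W.Ψ₃ := fun z => by
    rw [WeierstrassCurve.baseChange, WeierstrassCurve.map_Ψ₃, Polynomial.eval_map,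
      ← Polynomial.aeval_def]
  rw [hΨK, hΨK, show τ x = (τ : (AlgebraicClosure K) →ₐ[K] (AlgebraicClosure K)) x from rfl, Polynomial.aeval_algHom_apply]
  rfl

/-- **An affine point of order `3` has `y ≠ 0` (on a model with `a₁ = a₃ = 0`) and `Ψ₃(x) = 0`.**
[cite: SilvermanAEC2009, Exercise 3.7 (d)] -/
theorem eval_Ψ₃_eq_zero_of_three_smul (h1 : W.a₁ = 0) (h3 : W.a₃ = 0) {x y : (AlgebraicClosure K)}
    (h : (W.baseChange (AlgebraicClosure K)).toAffine.Nonsingular x y)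
    (h3P : (3 : ℤ) • (Affine.Point.some x y h : (W.baseChange (AlgebraicClosure K)).toAffine.Point) = 0) :
    y ≠ 0 ∧ (W.baseChange (AlgebraicClosure K)).Ψ₃.eval x = 0 := by
  have hy : y ≠ (W.baseChange (AlgebraicClosure K)).toAffine.negY x y := by
    intro hy
    have h2 : (2 : ℤ) • (Affine.Point.some x y h : (W.baseChange (AlgebraicClosure K)).toAffine.Point) = 0 := by
      rw [two_zsmul, add_eq_zero_iff_eq_neg, Affine.Point.neg_some]
      congr 1
    have h1P : (1 : ℤ) • (Affine.Point.some x y h : (W.baseChange (AlgebraicClosure K)).toAffine.Point) = 0 := by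
      rw [show (1 : ℤ) = 3 - 2 by norm_num, sub_zsmul, h3P, h2]
      simp
    rw [one_zsmul] at h1P
    exact Affine.Point.some_ne_zero h h1P
  refine ⟨?_, ?_⟩
  · rw [negY_baseChange_of_a₁_a₃ W h1 h3] at hy
    intro hy0; exact hy (by rw [hy0, neg_zero])
  · have := ((W.baseChange (AlgebraicClosure K)).three_smul_some_eq_zero_iff h hy).mp h3P
    rwa [ψ_three, Polynomial.evalEval_C] at this

/-- **Conversely, an affine point with `y ≠ 0` and `Ψ₃(x) = 0` has order `3`** (model with
`a₁ = a₃ = 0`). [cite: SilvermanAEC2009, Exercise 3.7 (d)] -/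
theorem three_smul_eq_zero_of_eval_Ψ₃ [CharZero K] (h1 : W.a₁ = 0) (h3 : W.a₃ = 0) {x y : (AlgebraicClosure K)}
    (h : (W.baseChange (AlgebraicClosure K)).toAffine.Nonsingular x y) (hy : y ≠ 0)
    (hΨ : (W.baseChange (AlgebraicClosure K)).Ψ₃.eval x = 0) :
    (3 : ℤ) • (Affine.Point.some x y h : (W.baseChange (AlgebraicClosure K)).toAffine.Point) = 0 := by
  have hy' : y ≠ (W.baseChange (AlgebraicClosure K)).toAffine.negY x y := by
    rw [negY_baseChange_of_a₁_a₃ W h1 h3]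
    intro hyy
    have : (2 : (AlgebraicClosure K)) * y = 0 := by linear_combination hyy
    exact hy ((mul_eq_zero.mp this).resolve_left two_ne_zero)
  apply ((W.baseChange (AlgebraicClosure K)).three_smul_some_eq_zero_iff h hy').mpr
  rw [ψ_three, Polynomial.evalEval_C, hΨ]

/-- In `E[3]`, `P + P = −P`. [folklore] -/
private theorem add_self_eq_neg_of_three_smul {G : Type*} [AddCommGroup G] {P : G} (h : (3 : ℤ) • P = 0) :
    P + P = -P := by
  rw [← sub_eq_zero, sub_neg_eq_add]
  have : (3 : ℤ) • P = P + P + P := by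
    rw [show (3 : ℤ) = 1 + 1 + 1 by norm_num, add_zsmul, add_zsmul, one_zsmul]
  rw [← this, h]

/-- In `E[3]`: `−(P + Q) = P` forces `Q = P` (`Q = −2P = P`). [folklore] -/
private theorem eq_of_neg_add_eq_left {G : Type*} [AddCommGroup G] {P Q : G} (hP : (3 : ℤ) • P = 0)
    (h : -(P + Q) = P) : Q = P := by
  have h' : P + Q = -P := by
    have := congrArg Neg.neg h
    simpa only [neg_neg] using this
  have e : Q = -P - P := by
    rw [eq_sub_iff_add_eq, add_comm]
    exact h'
  rw [e, sub_eq_add_neg, ← neg_add, add_self_eq_neg_of_three_smul hP, neg_neg]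

/-- In any group: `−(P + Q) = −P` forces `Q = 0`. [folklore] -/
private theorem eq_zero_of_neg_add_eq_neg_left {G : Type*} [AddCommGroup G] {P Q : G}
    (h : -(P + Q) = -P) : Q = 0 := by
  rw [neg_inj, add_eq_left] at h
  exact h

end Lemmas

/-! ### The transfer theorem -/

section Transfer

variable [CharZero K] (W W' : WeierstrassCurve K) [W.IsElliptic] [W'.IsElliptic]

/-- **A fractional-linear `3`-torsion transfer datum gives `E[3] ≅ E'[3]` as `Γ_K`-modules.**
See the module docstring. [cite: Fisher2012Hessian, Thm. 13.2 (n = 3)]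
[cite: SilvermanAEC2009, III.2.3 and Cor. III.6.4] -/
theorem threeCongruent_of_fracLinearDatum (hW1 : W.a₁ = 0) (hW3 : W.a₃ = 0) (hW'1 : W'.a₁ = 0)
    (hW'3 : W'.a₃ = 0) (a b c d e : K) (hdet : a * e - b * d ≠ 0) (hc : c ≠ 0)
    (hden : ∀ x : (AlgebraicClosure K), (W.baseChange (AlgebraicClosure K)).Ψ₃.eval x = 0 → (algebraMap K (AlgebraicClosure K)) d * x + (algebraMap K (AlgebraicClosure K)) e ≠ 0)
    (hΨ : ∀ x : (AlgebraicClosure K), (W.baseChange (AlgebraicClosure K)).Ψ₃.eval x = 0 →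
      (W'.baseChange (AlgebraicClosure K)).Ψ₃.eval (((algebraMap K (AlgebraicClosure K)) a * x + (algebraMap K (AlgebraicClosure K)) b) / ((algebraMap K (AlgebraicClosure K)) d * x + (algebraMap K (AlgebraicClosure K)) e)) = 0)
    (hEq : ∀ x y : (AlgebraicClosure K), (W.baseChange (AlgebraicClosure K)).toAffine.Equation x y → (W.baseChange (AlgebraicClosure K)).Ψ₃.eval x = 0 →
      (W'.baseChange (AlgebraicClosure K)).toAffine.Equation (((algebraMap K (AlgebraicClosure K)) a * x + (algebraMap K (AlgebraicClosure K)) b) / ((algebraMap K (AlgebraicClosure K)) d * x + (algebraMap K (AlgebraicClosure K)) e))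
        ((algebraMap K (AlgebraicClosure K)) c * y / ((algebraMap K (AlgebraicClosure K)) d * x + (algebraMap K (AlgebraicClosure K)) e))) :
    ∃ f : geomTorsion W (3 : ℤ) ≃+ geomTorsion W' (3 : ℤ),
      ∀ (σ : Field.absoluteGaloisGroup K) (P : geomTorsion W (3 : ℤ)), f (σ • P) = σ • f P := by
  -- shorthands (everything at the level of Mathlib points of `W/K̄`, `W'/K̄`)
  set V := W.baseChange (AlgebraicClosure K) with hV
  set V' := W'.baseChange (AlgebraicClosure K) with hV'
  have hdet' : (algebraMap K (AlgebraicClosure K)) a * (algebraMap K (AlgebraicClosure K)) e - (algebraMap K (AlgebraicClosure K)) b * (algebraMap K (AlgebraicClosure K)) d ≠ 0 := by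
    rw [← map_mul, ← map_mul, ← map_sub]; exact (map_ne_zero (algebraMap K (AlgebraicClosure K))).mpr hdet
  have hc' : ((algebraMap K (AlgebraicClosure K)) c) ≠ 0 := (map_ne_zero (algebraMap K (AlgebraicClosure K))).mpr hc
  have negY_V : ∀ x y : (AlgebraicClosure K), V.toAffine.negY x y = -y := negY_baseChange_of_a₁_a₃ W hW1 hW3
  have negY_V' : ∀ x y : (AlgebraicClosure K), V'.toAffine.negY x y = -y := negY_baseChange_of_a₁_a₃ W' hW'1 hW'3
  -- the map on coordinates
  set X' : (AlgebraicClosure K) → (AlgebraicClosure K) := fun x => ((algebraMap K (AlgebraicClosure K)) a * x + (algebraMap K (AlgebraicClosure K)) b) / ((algebraMap K (AlgebraicClosure K)) d * x + (algebraMap K (AlgebraicClosure K)) e) with hX'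
  set Y' : (AlgebraicClosure K) → (AlgebraicClosure K) → (AlgebraicClosure K) := fun x y => (algebraMap K (AlgebraicClosure K)) c * y / ((algebraMap K (AlgebraicClosure K)) d * x + (algebraMap K (AlgebraicClosure K)) e) with hY'
  have Y'_neg : ∀ x y, Y' x (-y) = -Y' x y := fun x y => by
    simp only [hY', mul_neg, neg_div]
  -- nonsingularity of the image of a `3`-division point
  have himNS : ∀ {x y : (AlgebraicClosure K)}, V.toAffine.Nonsingular x y → V.Ψ₃.eval x = 0 →
      V'.toAffine.Nonsingular (X' x) (Y' x y) := fun h hx =>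
    (Affine.equation_iff_nonsingular (W := V')).mp (hEq _ _ h.left hx)
  -- the map on points: `O ↦ O`, `(x, y) ↦ (X' x, Y' x y)` on `3`-division abscissae (junk `O` else)
  let fpt : V.toAffine.Point → V'.toAffine.Point := fun P =>
    match P with
    | .zero => 0
    | .some x y h => if hx : V.Ψ₃.eval x = 0 then .some (X' x) (Y' x y) (himNS h hx) else 0
  have fpt_zero : fpt 0 = 0 := rfl
  have fpt_some : ∀ {x y : (AlgebraicClosure K)} (h : V.toAffine.Nonsingular x y) (hx : V.Ψ₃.eval x = 0),
      fpt (.some x y h) = .some (X' x) (Y' x y) (himNS h hx) := by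
    intro x y h hx
    show (if hx : V.Ψ₃.eval x = 0 then _ else _) = _
    rw [dif_pos hx]
  -- facts about points of order 3
  have tors : ∀ {x y : (AlgebraicClosure K)} (h : V.toAffine.Nonsingular x y),
      (3 : ℤ) • (Affine.Point.some x y h : V.toAffine.Point) = 0 → y ≠ 0 ∧ V.Ψ₃.eval x = 0 :=
    fun h h3 => eval_Ψ₃_eq_zero_of_three_smul W hW1 hW3 h h3
  -- `fpt` maps `E[3]` into `E'[3]`
  have fpt_tors : ∀ {P : V.toAffine.Point}, (3 : ℤ) • P = 0 → (3 : ℤ) • fpt P = 0 := by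
    intro P hP
    rcases P with _ | ⟨x, y, h⟩
    · rw [← Affine.Point.zero_def, fpt_zero, zsmul_zero]
    · obtain ⟨hy, hx⟩ := tors h hP
      rw [fpt_some h hx]
      refine three_smul_eq_zero_of_eval_Ψ₃ W' hW'1 hW'3 (himNS h hx) ?_ (hΨ _ hx)
      exact div_ne_zero (mul_ne_zero hc' hy) (hden _ hx)
  -- `fpt` commutes with negation on `E[3]`
  have fpt_neg : ∀ {P : V.toAffine.Point}, (3 : ℤ) • P = 0 → fpt (-P) = -fpt P := by
    intro P hP
    rcases P with _ | ⟨x, y, h⟩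
    · rw [← Affine.Point.zero_def, neg_zero, fpt_zero, neg_zero]
    · obtain ⟨-, hx⟩ := tors h hP
      rw [Affine.Point.neg_some, fpt_some ((Affine.nonsingular_neg ..).mpr h) hx, fpt_some h hx,
        Affine.Point.neg_some]
      simp only [negY_V, negY_V', Y'_neg]
  -- `fpt` is injective on `E[3]`
  have fpt_inj : ∀ {P Q : V.toAffine.Point}, (3 : ℤ) • P = 0 → (3 : ℤ) • Q = 0 →
      fpt P = fpt Q → P = Q := by
    intro P Q hP hQ hPQ
    rcases P with _ | ⟨x₁, y₁, h₁⟩ <;> rcases Q with _ | ⟨x₂, y₂, h₂⟩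
    · rfl
    · obtain ⟨-, hx₂⟩ := tors h₂ hQ
      rw [← Affine.Point.zero_def, fpt_zero, fpt_some h₂ hx₂] at hPQ
      exact absurd hPQ.symm (Affine.Point.some_ne_zero _)
    · obtain ⟨-, hx₁⟩ := tors h₁ hP
      rw [← Affine.Point.zero_def, fpt_zero, fpt_some h₁ hx₁] at hPQ
      exact absurd hPQ (Affine.Point.some_ne_zero _)
    · obtain ⟨-, hx₁⟩ := tors h₁ hP
      obtain ⟨-, hx₂⟩ := tors h₂ hQ
      rw [fpt_some h₁ hx₁, fpt_some h₂ hx₂] at hPQ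
      simp only [Affine.Point.some.injEq] at hPQ
      obtain ⟨hx12, hy12⟩ := hPQ
      have hxx : x₁ = x₂ :=
        fracLinear_X_injective hdet' (hden _ hx₁) (hden _ hx₂) hx12
      subst hxx
      have hyy : y₁ = y₂ := by
        have hD := hden _ hx₁
        simp only [hY'] at hy12
        rw [div_left_inj' hD] at hy12
        exact mul_left_cancel₀ hc' hy12
      subst hyy
      rfl
  -- `fpt` is additive on `E[3]`
  have fpt_add : ∀ {P Q : V.toAffine.Point}, (3 : ℤ) • P = 0 → (3 : ℤ) • Q = 0 →
      fpt (P + Q) = fpt P + fpt Q := by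
    intro P Q hP3 hQ3
    rcases P with _ | ⟨x₁, y₁, h₁⟩
    · rw [← Affine.Point.zero_def, fpt_zero, zero_add, zero_add]
    rcases Q with _ | ⟨x₂, y₂, h₂⟩
    · rw [← Affine.Point.zero_def, fpt_zero, add_zero, add_zero]
    obtain ⟨hy₁, hx₁⟩ := tors h₁ hP3
    obtain ⟨hy₂, hx₂⟩ := tors h₂ hQ3
    by_cases hx : x₁ = x₂
    · -- `Q = P` or `Q = -P`
      subst hx
      rcases Affine.Y_eq_of_X_eq h₂.left h₁.left rfl with hy | hy
      · -- `Q = P`: `P + P = -P`, `f P + f P = -f P`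
        subst hy
        rw [add_self_eq_neg_of_three_smul hP3, fpt_neg hP3,
          add_self_eq_neg_of_three_smul (fpt_tors hP3)]
      · -- `Q = -P`
        have hQP : (Affine.Point.some x₁ y₂ h₂ : V.toAffine.Point) = -(Affine.Point.some x₁ y₁ h₁) := by
          rw [Affine.Point.neg_some]
          simp only [hy]
        rw [hQP, add_neg_cancel, fpt_neg hP3, add_neg_cancel, fpt_zero]
    · -- generic case: `R = -(P + Q)` is the third collinear point
      set L := V.toAffine.slope x₁ x₂ y₁ y₂ with hL
      set x₃ := V.toAffine.addX x₁ x₂ L with hx₃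
      set y₃ := V.toAffine.negAddY x₁ x₂ y₁ L with hy₃
      have h₃ : V.toAffine.Nonsingular x₃ y₃ := Affine.nonsingular_negAdd h₁ h₂ fun hxy => hx hxy.left
      have hR : -((Affine.Point.some x₁ y₁ h₁ : V.toAffine.Point) + Affine.Point.some x₂ y₂ h₂) =
          Affine.Point.some x₃ y₃ h₃ := Affine.neg_add_eq_some_addX_negAddY hx
      have hR3 : (3 : ℤ) • (Affine.Point.some x₃ y₃ h₃ : V.toAffine.Point) = 0 := by
        rw [← hR, zsmul_neg, zsmul_add, hP3, hQ3, add_zero, neg_zero]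
      obtain ⟨hy₃', hx₃'⟩ := tors h₃ hR3
      have hcol : (x₂ - x₁) * (y₃ - y₁) = (x₃ - x₁) * (y₂ - y₁) := Affine.collinear_negAdd hx
      -- `x₃ ∉ {x₁, x₂}`: otherwise `R = ±P` or `R = ±Q`, impossible in `E[3]` with `P ≠ ±Q`
      have h31 : x₃ ≠ x₁ := by
        intro h31
        rcases Affine.Y_eq_of_X_eq h₃.left h₁.left h31 with hyy | hyy
        · have hRP : (Affine.Point.some x₃ y₃ h₃ : V.toAffine.Point) = Affine.Point.some x₁ y₁ h₁ := by
            simp only [Affine.Point.some.injEq]; exact ⟨h31, hyy⟩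
          rw [hRP] at hR
          have := eq_of_neg_add_eq_left hP3 hR
          simp only [Affine.Point.some.injEq] at this
          exact hx this.1.symm
        · have hRP : (Affine.Point.some x₃ y₃ h₃ : V.toAffine.Point) = -Affine.Point.some x₁ y₁ h₁ := by
            rw [Affine.Point.neg_some]
            simp only [Affine.Point.some.injEq]; exact ⟨h31, hyy⟩
          rw [hRP] at hR
          exact absurd (eq_zero_of_neg_add_eq_neg_left hR) (Affine.Point.some_ne_zero _)
      have h32 : x₃ ≠ x₂ := by
        intro h32
        have hR' : -((Affine.Point.some x₂ y₂ h₂ : V.toAffine.Point) + Affine.Point.some x₁ y₁ h₁) =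
            Affine.Point.some x₃ y₃ h₃ := by rw [add_comm]; exact hR
        rcases Affine.Y_eq_of_X_eq h₃.left h₂.left h32 with hyy | hyy
        · have hRQ : (Affine.Point.some x₃ y₃ h₃ : V.toAffine.Point) = Affine.Point.some x₂ y₂ h₂ := by
            simp only [Affine.Point.some.injEq]; exact ⟨h32, hyy⟩
          rw [hRQ] at hR'
          have := eq_of_neg_add_eq_left hQ3 hR'
          simp only [Affine.Point.some.injEq] at this
          exact hx this.1
        · have hRQ : (Affine.Point.some x₃ y₃ h₃ : V.toAffine.Point) = -Affine.Point.some x₂ y₂ h₂ := by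
            rw [Affine.Point.neg_some]
            simp only [Affine.Point.some.injEq]; exact ⟨h32, hyy⟩
          rw [hRQ] at hR'
          exact absurd (eq_zero_of_neg_add_eq_neg_left hR') (Affine.Point.some_ne_zero _)
      -- images
      have hD₁ := hden _ hx₁
      have hD₂ := hden _ hx₂
      have hD₃ := hden _ hx₃'
      have hcol' := collinear_fracLinear (a := (algebraMap K (AlgebraicClosure K)) a) (b := (algebraMap K (AlgebraicClosure K)) b) (c := (algebraMap K (AlgebraicClosure K)) c) hD₁ hD₂ hD₃ hcol
      have hx12' : X' x₁ ≠ X' x₂ := fun h =>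
        hx (fracLinear_X_injective hdet' hD₁ hD₂ h)
      have hx31' : X' x₃ ≠ X' x₁ := fun h =>
        h31 (fracLinear_X_injective hdet' hD₃ hD₁ h)
      have hx32' : X' x₃ ≠ X' x₂ := fun h =>
        h32 (fracLinear_X_injective hdet' hD₃ hD₂ h)
      have key : (Affine.Point.some (X' x₁) (Y' x₁ y₁) (himNS h₁ hx₁) : V'.toAffine.Point) +
          Affine.Point.some (X' x₂) (Y' x₂ y₂) (himNS h₂ hx₂) =
          -Affine.Point.some (X' x₃) (Y' x₃ y₃) (himNS h₃ hx₃') :=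
        Affine.add_eq_neg_of_collinear hx12' hx31' hx32' hcol'
      -- assemble: f(P+Q) = f(-R) = -f(R) = f P + f Q
      have ePQ : (Affine.Point.some x₁ y₁ h₁ : V.toAffine.Point) + Affine.Point.some x₂ y₂ h₂ =
          -Affine.Point.some x₃ y₃ h₃ := by rw [← hR, neg_neg]
      rw [ePQ, fpt_neg hR3, fpt_some h₃ hx₃', fpt_some h₁ hx₁, fpt_some h₂ hx₂, key]
  -- `fpt` commutes with `Aut(K̄/K)` on `E[3]`
  have fpt_smul : ∀ (τ : (AlgebraicClosure K) ≃ₐ[K] (AlgebraicClosure K)) {P : V.toAffine.Point}, (3 : ℤ) • P = 0 →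
      fpt (τ • P) = τ • fpt P := by
    intro τ P hP
    rcases P with _ | ⟨x, y, h⟩
    · rw [← Affine.Point.zero_def, smul_zero, fpt_zero, smul_zero]
    · obtain ⟨-, hx⟩ := tors h hP
      obtain ⟨h', e1⟩ : ∃ h', τ • (Affine.Point.some x y h : V.toAffine.Point) =
          Affine.Point.some (τ x) (τ y) h' := ⟨_, rfl⟩
      have hτx : V.Ψ₃.eval (τ x) = 0 := by
        rw [hV, eval_Ψ₃_baseChange_algEquiv W τ x, ← hV, hx, map_zero]
      obtain ⟨h'', e2⟩ : ∃ h'', τ • (Affine.Point.some (X' x) (Y' x y) (himNS h hx) : V'.toAffine.Point) =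
          Affine.Point.some (τ (X' x)) (τ (Y' x y)) h'' := ⟨_, rfl⟩
      rw [e1, fpt_some h' hτx, fpt_some h hx, e2]
      simp only [hX', hY', algEquiv_fracLinear, algEquiv_fracLinear']
  -- transport to the tree's `geomTorsion` (a subgroup of the type synonym `geomPoints`)
  have mem3 : ∀ {P : geomPoints W}, P ∈ geomTorsion W (3 : ℤ) →
      (3 : ℤ) • (show V.toAffine.Point from P) = 0 := fun hP => (Submodule.mem_torsionBy_iff _ _).mp hP
  have mem3' : ∀ {P : V'.toAffine.Point}, (3 : ℤ) • P = 0 →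
      (show geomPoints W' from P) ∈ geomTorsion W' (3 : ℤ) := fun hP =>
    (Submodule.mem_torsionBy_iff _ _).mpr hP
  let g : geomTorsion W (3 : ℤ) →+ geomTorsion W' (3 : ℤ) :=
    { toFun := fun P => ⟨fpt P.1, mem3' (fpt_tors (mem3 P.2))⟩
      map_zero' := Subtype.ext fpt_zero
      map_add' := fun P Q => Subtype.ext (fpt_add (mem3 P.2) (mem3 Q.2)) }
  have g_inj : Function.Injective g := fun P Q h =>
    Subtype.ext (fpt_inj (mem3 P.2) (mem3 Q.2) (congrArg Subtype.val h))
  -- cardinalities: `#E[3] = #E'[3] = 9`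
  have h3 : ((3 : ℕ) : (AlgebraicClosure K)) ≠ 0 := by norm_num
  have hcardW : Nat.card (geomTorsion W (3 : ℤ)) = 3 ^ 2 :=
    card_torsionPoints_eq_sq_holds W (AlgebraicClosure K) (n := 3) h3
  have hcardW' : Nat.card (geomTorsion W' (3 : ℤ)) = 3 ^ 2 :=
    card_torsionPoints_eq_sq_holds W' (AlgebraicClosure K) (n := 3) h3
  haveI : Finite (geomTorsion W' (3 : ℤ)) := Nat.finite_of_card_ne_zero (by rw [hcardW']; norm_num)
  have g_bij : Function.Bijective g :=
    g_inj.bijective_of_nat_card_le (by rw [hcardW, hcardW'])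
  refine ⟨AddEquiv.ofBijective g g_bij, fun σ P => ?_⟩
  -- equivariance
  apply Subtype.ext
  change fpt (show V.toAffine.Point from ((σ • P : geomTorsion W (3 : ℤ)) : geomPoints W)) =
    (Field.absoluteGaloisGroup.toAlgEquiv K σ) • fpt P.1
  exact fpt_smul (Field.absoluteGaloisGroup.toAlgEquiv K σ) (mem3 P.2)

end Transfer

end Literature.NumberTheory.EllipticCurves.Fisher2012
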